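import Mathlib
import Summits.KontsevichZagierPeriods.Zeta5Search.Families.BasicGrowth
import HarnessLib

/-!
# ζ(5) search — Families: SYMMETRIES of the growth constant — `M_σ` is a class function on `D_n \ S_n / D_n`

HONEST FRAMING: systematic search; no irrationality claim unless certified.  STRUCTURAL facts about the size of
Brown's basic cellular integrals [Brown2016, §1.5 (1.3)–(1.4)] (seat P2, Families layer); nothing about the
arithmetic of any zeta value.

The growth constant `M_σ = fSup σ = sup_S f_σ` (`Families/BasicGrowth.lean`) is attached to a seating
`σ : Fin (ℓ+3) → Fin (ℓ+3)` (positions ↦ vertex labels `0,…,ℓ+1` finite, `ℓ+2 = ∞`).  Brown's census of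
configurations [Brown2016, §1.5, §8] is indexed by the DOUBLE COSETS of the dihedral group: relabelling the
positions of `σδ⁰` (domain) and the cyclic / reflection symmetry of `δ⁰` itself (range, i.e. the automorphisms of
`M_{0,n}` permuting the marked points dihedrally).  This file proves that `M_σ` is invariant under all four
generators, so that ONE certificate per census class (`Families/Atlas8Growth.lean`,
`Families/CellularEightGrowthConstants*.lean`) covers every seating:

* DOMAIN: `fSigma_shift` / `fSigma_reverse` (pointwise: `f_{σ(·+1)} = f_σ = f_{σ(−·)}`), `fSup_shift`,
  `fSup_reverse` — no hypothesis;
* RANGE REFLECTION `z ↦ 1 − z` (`reflIdx`: finite labels `k ↦ ℓ+1−k`, `∞ ↦ ∞`; `reflT t = (1 − t_ℓ,…,1 − t_1)`):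
  `ef_reflT` (every edge factor is preserved), `fSigma_reflect : f_{reflIdx ∘ σ}(reflT t) = f_σ(t)`,
  **`fSup_reflect : M_{reflIdx ∘ σ} = M_σ`** — no hypothesis;
* RANGE ROTATION `z_k ↦ z_{k+1}` (the cyclic symmetry of `M_{0,n}`; in simplicial coordinates it is the Möbius map
  `z ↦ 1 − t_1/z`, which sends `(z_2,…,z_{n−1}, z_n, z_1) = (t_1,…,1,∞,0)` to normal form `(0, s_1, …, s_ℓ, 1, ∞)` with
  `s_j = 1 − t_1/t_{j+1}`, `s_ℓ = 1 − t_1`: `rotT`): the EDGE LAW `ef_rotT_mul`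
  (`ef (rotT t) u v · ω(u+1) ω(v+1) = ef t (u+1) (v+1) · t_1` with the vertex weights `rotW`), `rotT_mem`,
  `fSigma_rotate : f_{σ+1}(t) = f_σ(rotT t)` for bijective `σ` (the weights cancel because every label is used
  twice above and twice below — Brown's homogeneity (5.2) for constant exponents), and
  **`fSup_rotate : M_{σ+1} = M_σ`** (bijective `σ`; `≤` from the change of variables, `≥` by iterating it `n` times),
  `fSup_add_nsmul : M_{σ + k·1} = M_σ`.
Together: `M_σ` depends only on the class of `σ` in `D_n \ S_n / D_n` (Brown's census classes).  Standard axioms only.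
-/

noncomputable section

open Finset

namespace Summit.KontsevichZagierPeriods.Zeta5Search.Families.Cellular

variable {ℓ : ℕ} (σ : Fin (ℓ + 3) → Fin (ℓ + 3))

/-! ### Two small facts about labels and edge factors -/

/-- `ef t u v = pt v − pt u` for labels `u < v` with `v` finite. -/
theorem ef_of_lt (t : Fin ℓ → ℝ) {u v : Fin (ℓ + 3)} (huv : u.val < v.val) (hv : v.val ≠ ℓ + 2) :
    ef t u v = pt t v.val - pt t u.val := by
  unfold ef
  rw [if_neg (by omega), max_eq_right huv.le, min_eq_left huv.le]

/-- In `Fin (ℓ+3)`: `(u + 1).val = u.val + 1` below the last label. -/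
theorem val_succ_of_lt {u : Fin (ℓ + 3)} (hu : u.val < ℓ + 2) : (u + 1).val = u.val + 1 :=
  Fin.val_add_one_of_lt (Fin.lt_def.2 (by rw [Fin.val_last]; exact hu))

/-- In `Fin (ℓ+3)`: the successor of the last label `∞ = ℓ+2` is `0`. -/
theorem succ_eq_zero_of_eq {u : Fin (ℓ + 3)} (hu : u.val = ℓ + 2) : u + 1 = 0 := by
  have : u = Fin.last (ℓ + 2) := Fin.ext (by rw [Fin.val_last]; exact hu)
  rw [this, Fin.last_add_one]

/-! ### Domain symmetries: relabelling the positions of `σδ⁰` -/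

/-- Shifting the positions, `σ ↦ σ(· + 1)`, does not change `f_σ` (the same cyclic product). -/
theorem fSigma_shift (t : Fin ℓ → ℝ) : fSigma (fun i => σ (i + 1)) t = fSigma σ t := by
  unfold fSigma formDen
  congr 1
  exact Fintype.prod_equiv (Equiv.addRight 1) _ _ fun i => rfl

/-- Reversing the positions, `σ ↦ σ(−·)`, does not change `f_σ` (the same edges, read backwards). -/
theorem fSigma_reverse (t : Fin ℓ → ℝ) : fSigma (fun i => σ (-i)) t = fSigma σ t := by
  unfold fSigma formDen
  congr 1
  refine Fintype.prod_equiv ((Equiv.addRight (1 : Fin (ℓ + 3))).trans (Equiv.neg _)) _ _ fun i => ?_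
  show ef t (σ (-i)) (σ (-(i + 1))) = ef t (σ (-(i + 1))) (σ (-(i + 1) + 1))
  rw [show -(i + 1) + 1 = -i by abel, ef_comm]

/-- `M_{σ(·+1)} = M_σ`. -/
theorem fSup_shift : fSup (fun i => σ (i + 1)) = fSup σ := by
  have h : fSigma (fun i => σ (i + 1)) = fSigma σ := funext (fSigma_shift σ)
  simp only [fSup, h]

/-- `M_{σ(−·)} = M_σ`. -/
theorem fSup_reverse : fSup (fun i => σ (-i)) = fSup σ := by
  have h : fSigma (fun i => σ (-i)) = fSigma σ := funext (fSigma_reverse σ)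
  simp only [fSup, h]

/-! ### Range reflection `z ↦ 1 − z` -/

/-- Reflection of the vertex labels induced by `z ↦ 1 − z`: finite points `k ↦ ℓ + 1 − k`, `∞ ↦ ∞`. -/
def reflIdx (u : Fin (ℓ + 3)) : Fin (ℓ + 3) :=
  if u.val = ℓ + 2 then u else ⟨ℓ + 1 - u.val, by omega⟩

/-- Value of `reflIdx` on a finite label. -/
theorem reflIdx_val_of_ne {u : Fin (ℓ + 3)} (hu : u.val ≠ ℓ + 2) : (reflIdx u).val = ℓ + 1 - u.val := by
  simp [reflIdx, hu]
/-- `reflIdx ∞ = ∞`. -/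
theorem reflIdx_of_eq {u : Fin (ℓ + 3)} (hu : u.val = ℓ + 2) : reflIdx u = u := by simp [reflIdx, hu]

/-- Reflection of the simplex: `t ↦ (1 − t_ℓ, …, 1 − t_1)`. -/
def reflT (t : Fin ℓ → ℝ) : Fin ℓ → ℝ := fun j => 1 - t (Fin.rev j)

/-- `reflT` is an involution. -/
theorem reflT_reflT (t : Fin ℓ → ℝ) : reflT (reflT t) = t := by
  funext j; simp [reflT, Fin.rev_rev]

/-- The marked points of the reflected simplex point: `pt (reflT t) k = 1 − pt t (ℓ + 1 − k)` (`k ≤ ℓ + 1`). -/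
theorem pt_reflT (t : Fin ℓ → ℝ) {k : ℕ} (hk : k ≤ ℓ + 1) : pt (reflT t) k = 1 - pt t (ℓ + 1 - k) := by
  rcases Nat.eq_zero_or_pos k with h0 | hpos
  · subst h0; rw [pt_zero, Nat.sub_zero, pt_of_gt t le_rfl]; ring
  · rcases eq_or_lt_of_le hk with h1 | hlt
    · subst h1; rw [pt_of_gt _ le_rfl, Nat.sub_self, pt_zero]; ring
    · rw [pt_of_pos _ hpos (by omega), pt_of_pos t (by omega) (by omega)]
      simp only [reflT]
      congr 2
      exact Fin.ext (by simp only [Fin.val_rev]; omega)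

/-- The gaps of the reflected point are the gaps read backwards. -/
theorem gapN_reflT (t : Fin ℓ → ℝ) {w : ℕ} (hw : w ≤ ℓ) : gapN (reflT t) w = gapN t (ℓ - w) := by
  unfold gapN
  rw [pt_reflT t (by omega), pt_reflT t (by omega), show ℓ - w + 1 = ℓ + 1 - w by omega,
    show ℓ + 1 - (w + 1) = ℓ - w by omega]
  ring

/-- `reflT` maps the open simplex to itself. -/
theorem reflT_mem {t : Fin ℓ → ℝ} (ht : t ∈ openSimplex ℓ) : reflT t ∈ openSimplex ℓ := by
  rw [mem_openSimplex_iff_gapN] at ht ⊢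
  intro w
  rw [gapN_reflT t (by omega)]
  exact ht ⟨ℓ - w.val, by omega⟩

/-- **Every edge factor is reflection invariant**: `ef (reflT t) (reflIdx u) (reflIdx v) = ef t u v`. -/
theorem ef_reflT (t : Fin ℓ → ℝ) (u v : Fin (ℓ + 3)) :
    ef (reflT t) (reflIdx u) (reflIdx v) = ef t u v := by
  by_cases hu : u.val = ℓ + 2
  · rw [reflIdx_of_eq hu, ef_infty_left _ _ _ hu, ef_infty_left _ _ _ hu]
  by_cases hv : v.val = ℓ + 2
  · rw [reflIdx_of_eq hv, ef_infty_right _ _ _ hv, ef_infty_right _ _ _ hv]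
  have hu' := reflIdx_val_of_ne hu
  have hv' := reflIdx_val_of_ne hv
  have hul : u.val ≤ ℓ + 1 := by have := u.isLt; omega
  have hvl : v.val ≤ ℓ + 1 := by have := v.isLt; omega
  unfold ef
  rw [if_neg (by omega), if_neg (by omega), hu', hv']
  rcases le_total u.val v.val with h | h
  · rw [max_eq_left (by omega : ℓ + 1 - v.val ≤ ℓ + 1 - u.val), min_eq_right (by omega : ℓ + 1 - v.val ≤ ℓ + 1 - u.val),
      max_eq_right h, min_eq_left h, pt_reflT t (by omega), pt_reflT t (by omega),
      show ℓ + 1 - (ℓ + 1 - u.val) = u.val by omega, show ℓ + 1 - (ℓ + 1 - v.val) = v.val by omega]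
    ring
  · rw [max_eq_right (by omega : ℓ + 1 - u.val ≤ ℓ + 1 - v.val), min_eq_left (by omega : ℓ + 1 - u.val ≤ ℓ + 1 - v.val),
      max_eq_left h, min_eq_right h, pt_reflT t (by omega), pt_reflT t (by omega),
      show ℓ + 1 - (ℓ + 1 - u.val) = u.val by omega, show ℓ + 1 - (ℓ + 1 - v.val) = v.val by omega]
    ring

/-- The numerator `∏_i (z_i − z_{i+1})` (the product of the gaps) is reflection invariant. -/
theorem prod_ef_succ_reflT (t : Fin ℓ → ℝ) :
    ∏ i : Fin (ℓ + 3), ef (reflT t) i (i + 1) = ∏ i : Fin (ℓ + 3), ef t i (i + 1) := by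
  rw [prod_ef_succ_eq_prod_gapN, prod_ef_succ_eq_prod_gapN]
  refine Fintype.prod_equiv Fin.revPerm _ _ fun w => ?_
  rw [gapN_reflT t (by omega), Fin.revPerm_apply, Fin.val_rev]
  congr 1
  omega

/-- The denominator transforms accordingly: `formDen (reflIdx ∘ σ) (reflT t) = formDen σ t`. -/
theorem formDen_reflect (t : Fin ℓ → ℝ) : formDen (fun i => reflIdx (σ i)) (reflT t) = formDen σ t := by
  unfold formDen
  exact Finset.prod_congr rfl fun i _ => ef_reflT t _ _

/-- **`f_{reflIdx ∘ σ}(reflT t) = f_σ(t)`.** -/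
theorem fSigma_reflect (t : Fin ℓ → ℝ) : fSigma (fun i => reflIdx (σ i)) (reflT t) = fSigma σ t := by
  unfold fSigma
  rw [prod_ef_succ_reflT, formDen_reflect]

/-- **Reflection invariance of the growth constant: `M_{reflIdx ∘ σ} = M_σ`** (no hypothesis on `σ`). -/
theorem fSup_reflect : fSup (fun i => reflIdx (σ i)) = fSup σ := by
  unfold fSup
  congr 1
  ext y
  constructor
  · rintro ⟨t, ht, rfl⟩
    exact ⟨reflT t, reflT_mem ht, by rw [← fSigma_reflect σ (reflT t), reflT_reflT]⟩
  · rintro ⟨t, ht, rfl⟩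
    exact ⟨reflT t, reflT_mem ht, fSigma_reflect σ t⟩

/-! ### Range rotation `z_k ↦ z_{k+1}`: the Möbius map `z ↦ 1 − t_1 / z` -/

/-- The change of variables of the cyclic relabelling: `s_j = 1 − t_1 / pt t (j + 2)` (`j = 0,…,ℓ−1`), i.e.
`(s_1,…,s_ℓ) = (1 − t_1/t_2, …, 1 − t_1/t_ℓ, 1 − t_1)`. -/
def rotT (t : Fin ℓ → ℝ) : Fin ℓ → ℝ := fun j => 1 - pt t 1 / pt t (j.val + 2)

/-- The marked points after the change of variables: `pt (rotT t) k = 1 − t_1 / pt t (k+1)` for `k ≤ ℓ`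
(and `pt (rotT t) (ℓ+1) = 1`). -/
theorem pt_rotT {t : Fin ℓ → ℝ} (h1 : pt t 1 ≠ 0) {k : ℕ} (hk : k ≤ ℓ) :
    pt (rotT t) k = 1 - pt t 1 / pt t (k + 1) := by
  rcases Nat.eq_zero_or_pos k with h0 | hpos
  · subst h0; rw [pt_zero, zero_add, div_self h1]; ring
  · rw [pt_of_pos _ hpos hk]
    show 1 - pt t 1 / pt t (k - 1 + 2) = _
    rw [show k - 1 + 2 = k + 1 by omega]

/-- The vertex weights of the Möbius map: `ω(0) = t_1` (the label `0` is sent to `∞`), `ω(x) = pt t x` for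
`1 ≤ x ≤ ℓ+1`, and `ω(∞) = pt t (ℓ+2) = 1`. -/
def rotW (t : Fin ℓ → ℝ) (x : Fin (ℓ + 3)) : ℝ := if x.val = 0 then pt t 1 else pt t x.val

/-- On the open simplex all marked points with label `≥ 1` are positive. -/
theorem pt_pos_of_pos {t : Fin ℓ → ℝ} (ht : t ∈ openSimplex ℓ) {k : ℕ} (hk : 1 ≤ k) : 0 < pt t k := by
  by_cases h : k ≤ ℓ + 1
  · have := pt_lt_pt ht (show 0 < k by omega) h
    rwa [pt_zero] at this
  · rw [pt_of_gt t (by omega)]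
    exact one_pos

/-- All vertex weights are positive on the open simplex. -/
theorem rotW_pos {t : Fin ℓ → ℝ} (ht : t ∈ openSimplex ℓ) (x : Fin (ℓ + 3)) : 0 < rotW t x := by
  unfold rotW
  split_ifs with h
  · exact pt_pos_of_pos ht le_rfl
  · exact pt_pos_of_pos ht (by omega)

/-- **The edge law of the Möbius map** (ordered labels): for `u < v`,
`ef (rotT t) u v · (ω(u+1) · ω(v+1)) = ef t (u+1) (v+1) · t_1`. -/
theorem ef_rotT_mul_of_lt {t : Fin ℓ → ℝ} (ht : t ∈ openSimplex ℓ) {u v : Fin (ℓ + 3)} (huv : u.val < v.val) :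
    ef (rotT t) u v * (rotW t (u + 1) * rotW t (v + 1)) = ef t (u + 1) (v + 1) * pt t 1 := by
  have h1 : pt t 1 ≠ 0 := (pt_pos_of_pos ht le_rfl).ne'
  have hvlt := v.isLt
  have hu1 : (u + 1).val = u.val + 1 := val_succ_of_lt (by omega)
  have hWu : rotW t (u + 1) = pt t (u.val + 1) := by
    unfold rotW
    rw [if_neg (by omega), hu1]
  have hpu : pt t (u.val + 1) ≠ 0 := (pt_pos_of_pos ht (by omega)).ne'
  by_cases hv2 : v.val = ℓ + 2
  · -- `v = ∞` in the `s`-picture, i.e. the label `0` in the `t`-picture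
    have hv0 : v + 1 = 0 := succ_eq_zero_of_eq hv2
    have hWv : rotW t (v + 1) = pt t 1 := by
      unfold rotW
      rw [if_pos (by rw [hv0, Fin.val_zero])]
    rw [ef_infty_right _ _ _ hv2, hWv, hWu]
    by_cases hul : u.val = ℓ + 1
    · -- the edge `{1, ∞}` of the `s`-picture = the edge `{∞, 0}` of the `t`-picture
      rw [ef_infty_left t _ _ (by omega), hul, pt_of_gt t (by omega)]
      ring
    · rw [ef_comm, ef_of_lt t (by rw [hv0, Fin.val_zero, hu1]; omega) (by omega), hu1, hv0, Fin.val_zero,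
        pt_zero, sub_zero, one_mul]
  by_cases hv1 : v.val = ℓ + 1
  · -- `v = 1` in the `s`-picture, i.e. `∞` in the `t`-picture
    have hv' : (v + 1).val = ℓ + 2 := by rw [val_succ_of_lt (by omega)]; omega
    have hWv : rotW t (v + 1) = 1 := by
      unfold rotW
      rw [if_neg (by omega), hv', pt_of_gt t (by omega)]
    rw [ef_of_lt _ huv (by omega), hv1, pt_of_gt (rotT t) le_rfl, pt_rotT h1 (by omega), hWu, hWv,
      ef_infty_right t _ _ hv']
    calc _ = pt t 1 / pt t (u.val + 1) * pt t (u.val + 1) := by ring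
      _ = _ := by rw [div_mul_cancel₀ _ hpu, one_mul]
  · -- both labels finite and `≤ ℓ` in the `s`-picture
    have hv' : (v + 1).val = v.val + 1 := val_succ_of_lt (by omega)
    have hWv : rotW t (v + 1) = pt t (v.val + 1) := by
      unfold rotW
      rw [if_neg (by omega), hv']
    have hpv : pt t (v.val + 1) ≠ 0 := (pt_pos_of_pos ht (by omega)).ne'
    rw [ef_of_lt _ huv (by omega), pt_rotT h1 (by omega), pt_rotT h1 (by omega), hWu, hWv,
      ef_of_lt t (by rw [hu1, hv']; omega) (by omega), hu1, hv']
    calc _ = pt t 1 / pt t (u.val + 1) * pt t (u.val + 1) * pt t (v.val + 1) -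
          pt t 1 / pt t (v.val + 1) * pt t (v.val + 1) * pt t (u.val + 1) := by ring
      _ = _ := by rw [div_mul_cancel₀ _ hpu, div_mul_cancel₀ _ hpv]; ring

/-- **The edge law of the Möbius map**: for distinct labels `u ≠ v`,
`ef (rotT t) u v · (ω(u+1) · ω(v+1)) = ef t (u+1) (v+1) · t_1`. -/
theorem ef_rotT_mul {t : Fin ℓ → ℝ} (ht : t ∈ openSimplex ℓ) {u v : Fin (ℓ + 3)} (huv : u ≠ v) :
    ef (rotT t) u v * (rotW t (u + 1) * rotW t (v + 1)) = ef t (u + 1) (v + 1) * pt t 1 := by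
  rcases Nat.lt_or_gt_of_ne (fun h => huv (Fin.ext h)) with h | h
  · exact ef_rotT_mul_of_lt ht h
  · rw [ef_comm, mul_comm (rotW t (u + 1)), ef_comm t]
    exact ef_rotT_mul_of_lt ht h

/-- `rotT` maps the open simplex into itself. -/
theorem rotT_mem {t : Fin ℓ → ℝ} (ht : t ∈ openSimplex ℓ) : rotT t ∈ openSimplex ℓ := by
  have h1 : 0 < pt t 1 := pt_pos_of_pos ht le_rfl
  rw [mem_openSimplex_iff_gapN]
  intro w
  unfold gapN
  by_cases hw : w.val + 1 ≤ ℓ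
  · rw [pt_rotT h1.ne' hw, pt_rotT h1.ne' (by omega)]
    have ha : 0 < pt t (w.val + 1) := pt_pos_of_pos ht (by omega)
    have hb : pt t (w.val + 1) < pt t (w.val + 1 + 1) := pt_lt_pt ht (by omega) (by omega)
    have : pt t 1 / pt t (w.val + 1 + 1) < pt t 1 / pt t (w.val + 1) := div_lt_div_of_pos_left h1 ha hb
    linarith
  · have hw' : w.val = ℓ := by omega
    rw [hw', pt_of_gt (rotT t) le_rfl, pt_rotT h1.ne' le_rfl, pt_of_gt t le_rfl, div_one]
    linarith [h1]

/-- A shifted bijective seating is bijective. -/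
theorem bijective_add_const (hσ : Function.Bijective σ) (c : Fin (ℓ + 3)) :
    Function.Bijective fun i => σ i + c :=
  ⟨fun a b h => hσ.1 (add_right_cancel h), fun y => by
    obtain ⟨x, hx⟩ := hσ.2 (y - c)
    exact ⟨x, by simp only [hx, sub_add_cancel]⟩⟩

/-- **`f_{σ+1}(t) = f_σ(rotT t)`** for a bijective seating: the cyclic relabelling of the vertices is the Möbius
change of variables `z ↦ 1 − t_1/z` (the vertex weights cancel: each label occurs twice in the numerator and twice
in the denominator). -/
theorem fSigma_rotate (hσ : Function.Bijective σ) {t : Fin ℓ → ℝ} (ht : t ∈ openSimplex ℓ) :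
    fSigma (fun i => σ i + 1) t = fSigma σ (rotT t) := by
  have h1 : pt t 1 ≠ 0 := (pt_pos_of_pos ht le_rfl).ne'
  set P : ℝ := ∏ x : Fin (ℓ + 3), rotW t x with hP
  have hP0 : P ≠ 0 := Finset.prod_ne_zero_iff.2 fun x _ => (rotW_pos ht x).ne'
  have hPP : P * P ≠ 0 := mul_ne_zero hP0 hP0
  have hc : pt t 1 ^ (ℓ + 3) ≠ 0 := pow_ne_zero _ h1
  -- reindexings of `∏ ω`
  have e1 : ∏ i : Fin (ℓ + 3), rotW t (i + 1) = P :=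
    Fintype.prod_equiv (Equiv.addRight 1) _ _ fun i => rfl
  have e2 : ∏ i : Fin (ℓ + 3), rotW t (i + 1 + 1) = P := by
    rw [← e1]
    exact Fintype.prod_equiv (Equiv.addRight 1) _ _ fun i => rfl
  have e3 : ∏ i : Fin (ℓ + 3), rotW t (σ i + 1) = P := by
    rw [← e1]
    exact Fintype.prod_equiv (Equiv.ofBijective σ hσ) _ _ fun i => rfl
  have e4 : ∏ i : Fin (ℓ + 3), rotW t (σ (i + 1) + 1) = P := by
    rw [← e3]
    exact Fintype.prod_equiv (Equiv.addRight 1) _ (fun j => rotW t (σ j + 1)) fun i => rfl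
  -- numerator: `N(rotT t) · P² = N(t) · t_1^n`
  have hnum : (∏ i : Fin (ℓ + 3), ef (rotT t) i (i + 1)) * (P * P) =
      (∏ i : Fin (ℓ + 3), ef t i (i + 1)) * pt t 1 ^ (ℓ + 3) := by
    have h : (∏ i : Fin (ℓ + 3), ef (rotT t) i (i + 1) * (rotW t (i + 1) * rotW t (i + 1 + 1))) =
        ∏ i : Fin (ℓ + 3), ef t (i + 1) (i + 1 + 1) * pt t 1 :=
      Finset.prod_congr rfl fun i _ => ef_rotT_mul ht (succ_ne_self i)
    rw [prod_mul_distrib, prod_mul_distrib, prod_mul_distrib, prod_const, card_univ, Fintype.card_fin, e1, e2] at h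
    rw [h]
    congr 1
    exact Fintype.prod_equiv (Equiv.addRight 1) _ _ fun i => rfl
  -- denominator: `D_σ(rotT t) · P² = D_{σ+1}(t) · t_1^n`
  have hden : formDen σ (rotT t) * (P * P) = formDen (fun i => σ i + 1) t * pt t 1 ^ (ℓ + 3) := by
    have h : (∏ i : Fin (ℓ + 3), ef (rotT t) (σ i) (σ (i + 1)) * (rotW t (σ i + 1) * rotW t (σ (i + 1) + 1))) =
        ∏ i : Fin (ℓ + 3), ef t (σ i + 1) (σ (i + 1) + 1) * pt t 1 :=
      Finset.prod_congr rfl fun i _ => ef_rotT_mul ht fun e => succ_ne_self i (hσ.1 e)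
    rw [prod_mul_distrib, prod_mul_distrib, prod_mul_distrib, prod_const, card_univ, Fintype.card_fin, e3, e4] at h
    exact h
  have hA : (∏ i : Fin (ℓ + 3), ef (rotT t) i (i + 1)) =
      (∏ i : Fin (ℓ + 3), ef t i (i + 1)) * (pt t 1 ^ (ℓ + 3) / (P * P)) := by
    rw [← mul_div_assoc, eq_div_iff hPP]
    exact hnum
  have hB : formDen σ (rotT t) = formDen (fun i => σ i + 1) t * (pt t 1 ^ (ℓ + 3) / (P * P)) := by
    rw [← mul_div_assoc, eq_div_iff hPP]
    exact hden
  unfold fSigma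
  rw [hA, hB, mul_div_mul_right _ _ (div_ne_zero hc hPP)]

/-- `M_{σ+1} ≤ M_σ` (from the change of variables). -/
theorem fSup_rotate_le (hσ : Function.Bijective σ) : fSup (fun i => σ i + 1) ≤ fSup σ :=
  fSup_le_of_forall_le _ fun t ht => by
    rw [fSigma_rotate σ hσ ht]
    exact fSigma_le_fSup σ hσ (rotT_mem ht)

/-- **Rotation invariance of the growth constant: `M_{σ+1} = M_σ`** for every bijective seating (iterate the
one-sided bound `n = ℓ + 3` times, `σ + n·1 = σ`). -/
theorem fSup_rotate (hσ : Function.Bijective σ) : fSup (fun i => σ i + 1) = fSup σ := by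
  refine le_antisymm (fSup_rotate_le σ hσ) ?_
  -- `M_{τ + k·1} ≤ M_τ` for every bijective `τ` and every `k`
  have key : ∀ (k : ℕ) (τ : Fin (ℓ + 3) → Fin (ℓ + 3)), Function.Bijective τ →
      fSup (fun i => τ i + k • (1 : Fin (ℓ + 3))) ≤ fSup τ := by
    intro k
    induction k with
    | zero => intro τ _; simp
    | succ k ih =>
      intro τ hτ
      have hb := bijective_add_const τ hτ (k • (1 : Fin (ℓ + 3)))
      calc fSup (fun i => τ i + (k + 1) • (1 : Fin (ℓ + 3)))
          = fSup (fun i => (τ i + k • (1 : Fin (ℓ + 3))) + 1) := by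
            congr 1
            funext i
            rw [succ_nsmul, add_assoc]
        _ ≤ fSup (fun i => τ i + k • (1 : Fin (ℓ + 3))) := fSup_rotate_le _ hb
        _ ≤ fSup τ := ih τ hτ
  have h : fSup (fun i => σ i + 1 + (ℓ + 2) • (1 : Fin (ℓ + 3))) ≤ fSup (fun i => σ i + 1) :=
    key (ℓ + 2) (fun i => σ i + 1) (bijective_add_const σ hσ 1)
  have e : (fun i => σ i + 1 + (ℓ + 2) • (1 : Fin (ℓ + 3))) = σ := by
    funext i
    have hn : (ℓ + 2 + 1) • (1 : Fin (ℓ + 3)) = 0 := by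
      have h0 : Fintype.card (Fin (ℓ + 3)) • (1 : Fin (ℓ + 3)) = 0 := card_nsmul_eq_zero
      rwa [Fintype.card_fin] at h0
    rw [add_assoc, ← succ_nsmul', hn, add_zero]
  rw [e] at h
  exact h

/-- **`M_{σ + k·1} = M_σ`**: invariance under every rotation of the labels (iterate `fSup_rotate`). -/
theorem fSup_add_nsmul (hσ : Function.Bijective σ) (k : ℕ) :
    fSup (fun i => σ i + k • (1 : Fin (ℓ + 3))) = fSup σ := by
  induction k with
  | zero => simp
  | succ k ih =>
    rw [← ih, ← fSup_rotate _ (bijective_add_const σ hσ (k • (1 : Fin (ℓ + 3))))]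
    congr 1
    funext i
    show σ i + (k + 1) • (1 : Fin (ℓ + 3)) = σ i + k • (1 : Fin (ℓ + 3)) + 1
    rw [succ_nsmul, add_assoc]

end Summit.KontsevichZagierPeriods.Zeta5Search.Families.Cellular
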